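import Mathlib
import Literature.MathematicalPhysics.QuantumFieldTheory.Balaban1983to89.B6Ineq268From267
import Literature.MathematicalPhysics.QuantumFieldTheory.Balaban1983to89.B6Prop22BoxFamily

/-!
# `Balaban1983to89.B6Ineq268OneScaleBox` — T. Bałaban, *Propagators and renormalization transformations for lattice gauge
theories. II*, Commun. Math. Phys. **96** (1984) 223–250 [Balaban1984PropagatorsII], p. 235: (2.68) ON THE ONE-SCALE BOX,
HYPOTHESIS-FREE — the companion `…B6Ineq268From267` ((2.67) ⟹ (2.68) end-to-end, members 1–6) instantiated on the
one-scale box family of this seat's gen 3 (`…B6OneScaleBoxFamily`: blocks = sites, Q′ = Q′₀ = I, G′ = (−Δ_𝔅 + a)⁻¹), with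
EVERY hypothesis of `B6Ineq268From267.ineq268_of_267` discharged

statement-level skeleton of published theorems with citation tags; proofs where landed; nothing here is a claim about the Yang–Mills mass gap.
PDF held: `paper:balaban1984-cmp96-propagators-rt-ii` (journal page = PDF page + 222); p. 235 [PDF 13] re-read AS AN IMAGE
this session on the ×2 render `run/shared/lean/pub/pub-balaban/b2b-balaban-ref1/pages/1984-cmp96-propagators-rt-II/
1984-cmp96-propagators-rt-II-p013-x2.png`.

CITATION HEADER (cell `lit-balaban`, HOME `run/shared/lean/pub/lit-balaban/`; Phase-2 proof seat `p01` gen 4 = unit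
`lit-balaban-p01`; `PHASE2-TARGETS.md` §G, G.5-34(d)).  SKELETON row **`B6.Eq2.68`** of `HOME/lit-balaban-r03/ROWS-B6.md`
(owner r03, referee ref-4), Phase-2 kind «model instance» (one scale).  IMPORTED, NOT MODIFIED: `…B6Ineq268From267` (this
seat, gen 4: `ineq268_of_267`), `…B6Prop22BoxFamily` / `…B6OneScaleBoxFamily` / `…B6Prop22BoxLaplacian` (this seat, gen 3:
`oneScaleGeo`, `green`, `entry0_le`, `prop22_entry1_neumannLaplacian`), `…B6CoverBox` (cell pub-balaban b06-g17: `bdist`,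
`Kbox`, `boxGeo_profile`), `…B6Ineq2142` (r03 g5: `avgOp`, `avgAdj`, `kernelW`), `…B6Ineq268` (b06-g5: `Symm`, `LevelSep`,
`mx`), `…B6Lemma21Repaired` (`Ineq261With`), `…QGQInverse` (`mulVec_single_one_apply`).

WHAT THE PAPER PRINTS (p. 235 [PDF 13], verbatim): *"The inequalities (2.67) imply |(Q′G′²Q′*)(y, y′)| =
|Σ_{y″∈𝔅} (Q′G′Δ(y″)G′Q′*)(y, y′)| ≤ … ≤ O(1)(L^jη)⁴(L^{j′}η)^{−d} e^{−¼δ₀d(y,y′)}, (2.68) where we have used the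
inequalities (2.60), (2.63) of Lemma 1."* and *"If we have one scale, i.e. Λ_k = T₁^{(k)}, then the operator is a unit
lattice operator."*; (2.13)–(2.14) p. 225: *"Δ′_a = Δ + Q′*aQ′ … (Q′₀λ)(x) = λ(x), x ∈ Λ₀"*.

WHAT IS PROVED HERE (0 `sorry`, 0 definitions, 0 named facts; axioms = the standard three), on the box 𝔅 = {0,…,nM}^d
read as `oneScaleGeo d n M` (one scale: blocks = sites, L^jη = 1 so (L^jη)⁴(L^{j′}η)^{−d} ≡ 1, Q′ = I with kernel
q(y,x) = δ_{y,x} so κ₁ = κ₂ = 1, d(y,y′) = |y − y′|₁):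
* `sum_abs_idKernel` (κ₁ = 1), `oneScale_kernel_eq` (the (2.69)-kernel of Q′G′²Q′* IS the matrix square (G′G′)(y,y′));
* **`ineq268_box_of_kernel`**: ANY matrix G′ with `|G′(x,z)| ≤ C₀e^{−r|x−z|₁}` (= (2.67)₁ on one scale, ½δ₀ := r) has
  `|(G′²)(y,y′)| ≤ C₀²K(¼·2r)e^{−¼·2r|y−y′|₁}` (K = `Kbox d`), uniformly in the volume — `ineq268_of_267` with (2.67)₁ from
  the kernel bound (`entry0_le`), (2.54)/symmetry from the ℓ¹ distance, (2.60)/`LevelSep` vacuous (one scale), (2.61) at ¼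
  from the box lattice sums `boxGeo_profile`, the threshold `L² ≤ e^{¼δ₀RM}` free at L = 1;
* **`ineq268_oneScaleBox`**: the same for the operator of Proposition 2.2, `G′ = (−Δ_𝔅 + a)⁻¹` (`green`), from this seat's
  box form of (2.67)₁ (`prop22_entry1_neumannLaplacian`: a > 0, 2d(e^{δ₀} − 1) < a, 0 < α < 1, M above the explicit
  threshold) — NO hypothesis of printed shape left;
* **`ineq268_oneScaleBox_family`**: the ∃-form over the family (n, M): M₁, δ₁, C > 0 depending on d, a only with
  `|(G′²)(y,y′)| ≤ Ce^{−δ₁|y−y′|₁}` for every member with M ≥ M₁ (*"M sufficiently large"* explicit), uniformly in the volume.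
HONEST SCOPE.  One scale only (the multi-scale content of (2.68) — d(y,y′) of (2.46), the powers (L^jη)⁴(L^{j′}η)^{−d},
(2.60) — is exercised by the companion's general theorem, not by this instance); box with the Neumann conventions of
`…B6OneScaleBoxFamily`, not the torus.  Value = the non-vacuity / model instance of the companion's implication; NOT summit
progress.
-/

namespace Literature.MathematicalPhysics.QuantumFieldTheory.Balaban1983to89.B6Ineq268OneScaleBox

open Finset
open B6Ineq2142 (avgOp avgAdj kernelW avgOp_apply)
open B6Ineq268From267 (ineq268_of_267)

/-! ## The one-scale box instance: `Q′ = I`, blocks = sites, `G′ = (−Δ_𝔅 + a)⁻¹` — no hypothesis left -/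

section Box

open Matrix
open B6CoverBox (bdist Kbox bdist_self bdist_comm bdist_triangle bdist_nonneg)
open B6OneScaleBoxFamily (oneScaleGeo green negLap oneScaleGeo_len)
open B6Prop22BoxLaplacian (prop22_entry1_neumannLaplacian)

variable {d n m : ℕ}

/-- The ℓ¹-mass of the identity kernel `q(b,x) = δ_{b,x}` (Q′ = Q′₀ = I on one scale, (2.14)) is 1.
[cite: Balaban1984PropagatorsII, (2.14) p.225] -/
theorem sum_abs_idKernel (b : Fin d → Fin (n * m + 1)) :
    ∑ x : Fin d → Fin (n * m + 1), |(if x = b then (1 : ℝ) else 0)| = 1 := by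
  have h : ∀ x : Fin d → Fin (n * m + 1), |(if x = b then (1 : ℝ) else 0)| = if x = b then (1 : ℝ) else 0 := by
    intro x
    split_ifs <;> simp
  simp_rw [h]
  rw [Finset.sum_ite_eq']
  simp

/-- On one scale the (2.69)-kernel of `Q′G′²Q′*` (Q′ = I, weights (L^jη)^d = 1) IS the matrix square:
`(Q′G′²Q′*)(y,y′) = (G′G′)(y,y′)`. [cite: Balaban1984PropagatorsII, (2.68)–(2.69) p.235] -/
theorem oneScale_kernel_eq (G : Matrix (Fin d → Fin (n * m + 1)) (Fin d → Fin (n * m + 1)) ℝ)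
    (y y' : Fin d → Fin (n * m + 1)) :
    kernelW (fun z => (oneScaleGeo d n m).len z ^ d)
        (avgOp (fun b x => if x = b then (1 : ℝ) else 0) ∘ₗ Matrix.toLin' G ∘ₗ Matrix.toLin' G ∘ₗ
          avgAdj 1 (fun z => (oneScaleGeo d n m).len z ^ d) (fun b x => if x = b then (1 : ℝ) else 0)) y y' =
      (G * G) y y' := by
  have hW : ∀ z : Fin d → Fin (n * m + 1), (oneScaleGeo d n m).len z ^ d = 1 := fun z => by
    rw [oneScaleGeo_len, one_pow]
  have hJ : avgAdj 1 (fun z => (oneScaleGeo d n m).len z ^ d) (fun b x => if x = b then (1 : ℝ) else 0)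
      (Pi.single y' 1) = Pi.single y' (1 : ℝ) := by
    funext x
    rw [B6Ineq2142.avgAdj_single, hW, inv_one, one_mul, one_mul]
    by_cases hx : x = y'
    · subst hx; simp
    · simp [hx]
  simp only [B6Ineq2142.kernelW, B6Prop23Chain.mat, LinearMap.comp_apply]
  rw [hW, div_one, hJ, Matrix.toLin'_apply, Matrix.toLin'_apply, Matrix.mulVec_mulVec, avgOp_apply]
  have h : ∀ x : Fin d → Fin (n * m + 1),
      (if x = y then (1 : ℝ) else 0) * ((G * G) *ᵥ Pi.single y' 1) x =
        if x = y then ((G * G) *ᵥ Pi.single y' 1) x else 0 := by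
    intro x
    split_ifs <;> simp
  simp_rw [h]
  rw [Finset.sum_ite_eq']
  simp only [Finset.mem_univ, if_true]
  exact QGQInverse.mulVec_single_one_apply (G * G) y y'

/-- **(2.68) on the one-scale box from a kernel bound (every hypothesis of `ineq268_of_267` discharged).**  On the box
`𝔅 = {0,…,nM}^d` read as the one-scale geometry `oneScaleGeo` (blocks = sites, L^jη = 1, Q′ = I, d(y,y′) = |y − y′|₁,
(2.60) vacuous, L = 1 so the threshold `L² ≤ e^{¼δ₀RM}` is free, (2.61) at ¼ = the box lattice sum `boxGeo_profile`), ANY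
matrix `G′` with `|G′(x,z)| ≤ C₀e^{−r|x−z|₁}` (which IS (2.67)₁ on one scale, rate ½δ₀ := r) has
`|(G′²)(y,y′)| ≤ C₀²·K(¼·2r)·e^{−¼·2r·|y−y′|₁}`, K = `Kbox d`, uniformly in the volume. [cite: Balaban1984PropagatorsII, (2.68) p.235] -/
theorem ineq268_box_of_kernel {G : Matrix (Fin d → Fin (n * m + 1)) (Fin d → Fin (n * m + 1)) ℝ} {C₀ r : ℝ}
    (hr : 0 < r) (hG : ∀ x z, |G x z| ≤ C₀ * Real.exp (-(r * bdist x z))) (y y' : Fin d → Fin (n * m + 1)) :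
    |(G * G) y y'| ≤ C₀ ^ 2 * Kbox d (1 / 4 * (2 * r)) * Real.exp (-(1 / 4 * (2 * r) * bdist y y')) := by
  classical
  have hC : 0 ≤ C₀ := by
    have h := hG y y
    rw [bdist_self, mul_zero, neg_zero, Real.exp_zero, mul_one] at h
    exact le_trans (abs_nonneg _) h
  -- the data of `ineq268_of_267` on `oneScaleGeo d n m`, blocks = sites, `Q′ = I`
  have hη : 0 < (oneScaleGeo d n m).eta := by show (0 : ℝ) < 1; norm_num
  have hqR : ∀ (b x : Fin d → Fin (n * m + 1)), (if x = b then (1 : ℝ) else 0) ≠ 0 → id x = b := by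
    intro b x h
    by_contra hne
    exact h (if_neg hne)
  have hq1 : ∀ b : Fin d → Fin (n * m + 1), ∑ x : Fin d → Fin (n * m + 1), |(if x = b then (1 : ℝ) else 0)| ≤ 1 :=
    fun b => (sum_abs_idKernel b).le
  have hq2 : ∀ (b x : Fin d → Fin (n * m + 1)),
      |(if x = b then (1 : ℝ) else 0)| ≤ 1 * 1 / (oneScaleGeo d n m).len b ^ d := by
    intro b x
    rw [oneScaleGeo_len, one_pow]
    split_ifs <;> norm_num
  have h267 : ∀ (b b' : Fin d → Fin (n * m + 1)) (J : (Fin d → Fin (n * m + 1)) → ℝ) (M : ℝ),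
      (∀ x, J x ≠ 0 → id x = b') → (∀ x, |J x| ≤ M) → ∀ x, id x = b →
        |Matrix.toLin' G J x| ≤ C₀ * (oneScaleGeo d n m).len b ^ 2 *
          Real.exp (-(1 / 2 * (2 * r) * (oneScaleGeo d n m).dist b b')) * M := by
    intro b b' J M hJ hJM x hx
    have hxb : x = b := hx
    subst hxb
    have hlam : ∀ z, z ≠ b' → J z = 0 := fun z hz => by
      by_contra h
      exact hz (hJ z h)
    have h0 := B6Prop22BoxFamily.entry0_le hG hlam x
    have hMb : |J b'| ≤ M := hJM b'
    have hrate : (1 : ℝ) / 2 * (2 * r) = r := by ring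
    rw [Matrix.toLin'_apply, oneScaleGeo_len, one_pow, mul_one, hrate]
    show |(G *ᵥ J) x| ≤ C₀ * Real.exp (-(r * bdist x b')) * M
    exact h0.trans (mul_le_mul_of_nonneg_left hMb (by positivity))
  have htri : B6RandomWalk.Triangle254 (oneScaleGeo d n m) := fun a b c => bdist_triangle a b c
  have hsymm : B6Ineq268.Symm (oneScaleGeo d n m) := fun a b => bdist_comm a b
  have hsep : B6Ineq268.LevelSep (oneScaleGeo d n m) := by
    intro a b
    have hmx : B6Ineq268.mx (oneScaleGeo d n m) a b = 0 := by
      unfold B6Ineq268.mx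
      show max (|((0 : ℕ) : ℝ) - ((0 : ℕ) : ℝ)| - 1) 0 = 0
      norm_num
    rw [hmx, mul_zero]
    exact bdist_nonneg a b
  have hL1 : 1 ≤ (oneScaleGeo d n m).L := by show (1 : ℝ) ≤ 1; exact le_rfl
  have hRM : 0 ≤ (oneScaleGeo d n m).R * (oneScaleGeo d n m).M := by show (0 : ℝ) ≤ 1 * (m : ℝ); positivity
  have hδ : 0 ≤ 2 * r := by positivity
  have h261 : B6Lemma21Repaired.Ineq261With (Kbox d (1 / 4 * (2 * r))) (oneScaleGeo d n m) (2 * r) (1 / 4) := by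
    intro s
    exact B6CoverBox.boxGeo_profile d n m 0 0 1 1 1 (1 / 4 * (2 * r)) (by positivity) s
  have hthr : (oneScaleGeo d n m).L ^ 2 ≤
      Real.exp (1 / 4 * (2 * r) * (oneScaleGeo d n m).R * (oneScaleGeo d n m).M) := by
    show (1 : ℝ) ^ 2 ≤ Real.exp (1 / 4 * (2 * r) * 1 * (m : ℝ))
    rw [one_pow]
    exact Real.one_le_exp (by positivity)
  have key := ineq268_of_267 (oneScaleGeo d n m) d (Matrix.toLin' G) (fun b x => if x = b then (1 : ℝ) else 0) id
    one_pos hη hC zero_le_one hqR hq1 hq2 h267 htri hsymm hsep hL1 hRM hδ h261 hthr y y'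
  have hLeq : (oneScaleGeo d n m).L = 1 := rfl
  have hdist : (oneScaleGeo d n m).dist y y' = bdist y y' := rfl
  rw [oneScale_kernel_eq G y y', hLeq, hdist, oneScaleGeo_len, oneScaleGeo_len] at key
  refine key.trans (le_of_eq ?_)
  simp

/-- **(2.68) on the one-scale box for the operator of Proposition 2.2, hypothesis-free.**  With
`G′ = (−Δ_𝔅 + a)⁻¹` (`…B6OneScaleBoxFamily.green`, the Δ′_a = Δ + Q′*aQ′ of (2.13) on one scale): for `a > 0`, `0 < δ₀`
with `2d(e^{δ₀} − 1) < a`, `0 < α < 1` and *"M sufficiently large"* explicitly as in this seat's box form of Proposition 2.2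
(`prop22_entry1_neumannLaplacian`: `|G′(x,y)| ≤ C₀e^{−(1−α)δ₀|x−y|₁}`, `C₀ = 2^dAK(αδ₀)(1 − 2^d(3π/2)A(2de^{δ₀})M⁻¹K(αδ₀))⁻¹`,
`A = (a − 2d(e^{δ₀} − 1))⁻¹`, K = `Kbox d`), the kernel of `Q′G′²Q′* = G′²` obeys
`|(G′²)(y,y′)| ≤ C₀²·K(¼·2(1−α)δ₀)·e^{−¼·2(1−α)δ₀·|y−y′|₁}` uniformly in the volume. [cite: Balaban1984PropagatorsII, (2.68) p.235] -/
theorem ineq268_oneScaleBox (hm : 0 < m) {a δ₀ α : ℝ} (ha : 0 < a) (hδ₀ : 0 < δ₀) (hα : 0 < α) (hα1 : α < 1)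
    (hρ : 2 * d * (Real.exp δ₀ - 1) < a)
    (hM : (2 : ℝ) ^ d * (3 * Real.pi / 2 * (a - 2 * d * (Real.exp δ₀ - 1))⁻¹ * (2 * d * Real.exp δ₀)) *
      Kbox d (α * δ₀) < m) (y y' : Fin d → Fin (n * m + 1)) :
    |(green d n m a * green d n m a) y y'| ≤
      ((2 : ℝ) ^ d * (a - 2 * d * (Real.exp δ₀ - 1))⁻¹ * Kbox d (α * δ₀) *
        (1 - (2 : ℝ) ^ d * (3 * Real.pi / 2 * (a - 2 * d * (Real.exp δ₀ - 1))⁻¹ * (2 * d * Real.exp δ₀) / m) *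
          Kbox d (α * δ₀))⁻¹) ^ 2 * Kbox d (1 / 4 * (2 * ((1 - α) * δ₀))) *
        Real.exp (-(1 / 4 * (2 * ((1 - α) * δ₀)) * bdist y y')) := by
  classical
  have hker : ∀ x z : Fin d → Fin (n * m + 1), |green d n m a x z| ≤
      (2 : ℝ) ^ d * (a - 2 * d * (Real.exp δ₀ - 1))⁻¹ * Kbox d (α * δ₀) *
        (1 - (2 : ℝ) ^ d * (3 * Real.pi / 2 * (a - 2 * d * (Real.exp δ₀ - 1))⁻¹ * (2 * d * Real.exp δ₀) / m) *
          Kbox d (α * δ₀))⁻¹ * Real.exp (-((1 - α) * δ₀ * bdist x z)) :=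
    fun x z => prop22_entry1_neumannLaplacian (d := d) (n := n) (m := m) hm ha hδ₀ hα hα1.le hρ hM x z
  exact ineq268_box_of_kernel (mul_pos (by linarith) hδ₀) hker y y'

/-- **(2.68) on the one-scale box FAMILY, ∃-form** (the shape of `B6.Prop23Printed`'s input (2.87)-type kernel bound, with
(L^jη)⁴(L^{j′}η)^{−d} ≡ 1 on one scale): for every d and a > 0 there are M₁, δ₁, C > 0 (depending on d, a only) such that
for every member (n, M) of the family with M ≥ M₁ and all sites y, y′ of the box,
`|(G′²)(y,y′)| ≤ C·e^{−δ₁|y−y′|₁}` — *"M sufficiently large"* made explicit, uniformly in the volume.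
[cite: Balaban1984PropagatorsII, (2.68) p.235] -/
theorem ineq268_oneScaleBox_family (d : ℕ) {a : ℝ} (ha : 0 < a) :
    ∃ M₁ δ₁ C : ℝ, 0 < M₁ ∧ 0 < δ₁ ∧ 0 < C ∧ ∀ n m : ℕ, M₁ ≤ (m : ℝ) →
      ∀ y y' : Fin d → Fin (n * m + 1),
        |(green d n m a * green d n m a) y y'| ≤ C * Real.exp (-(δ₁ * bdist y y')) := by
  classical
  -- the rate δ₀ = log(1 + a/(4(d+1))): 2d(e^{δ₀} − 1) = a·d/(2(d+1)) < a (as in `prop22Printed_boxFamily`)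
  set δ₀ : ℝ := Real.log (1 + a / (4 * (d + 1))) with hδ₀def
  have hq : 0 < a / (4 * ((d : ℝ) + 1)) := by positivity
  have hδ₀ : 0 < δ₀ := Real.log_pos (by linarith)
  have hexp : Real.exp δ₀ = 1 + a / (4 * (d + 1)) := by rw [hδ₀def, Real.exp_log (by linarith)]
  have hρ : 2 * (d : ℝ) * (Real.exp δ₀ - 1) < a := by
    rw [hexp, add_sub_cancel_left]
    have hd1 : (0 : ℝ) < 4 * ((d : ℝ) + 1) := by positivity
    rw [mul_div_assoc', div_lt_iff₀ hd1]
    nlinarith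
  set A : ℝ := (a - 2 * d * (Real.exp δ₀ - 1))⁻¹ with hAdef
  have hA : 0 < A := inv_pos.mpr (by linarith)
  set K : ℝ := Kbox d (1 / 2 * δ₀) with hKdef
  have hK : 0 ≤ K := B6CoverBox.Kbox_nonneg d (by linarith)
  set X : ℝ := (2 : ℝ) ^ d * (3 * Real.pi / 2 * A * (2 * d * Real.exp δ₀)) * K with hXdef
  have hX : 0 ≤ X := by positivity
  set r : ℝ := (1 - 1 / 2) * δ₀ with hrdef
  have hr : 0 < r := by rw [hrdef]; linarith
  have hK' : 0 < Kbox d (1 / 4 * (2 * r)) := by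
    unfold Kbox
    apply pow_pos
    have : Real.exp (-(1 / 4 * (2 * r))) < 1 := Real.exp_lt_one_iff.2 (by linarith)
    have : 0 < 1 - Real.exp (-(1 / 4 * (2 * r))) := by linarith
    positivity
  refine ⟨2 * X + 1, 1 / 4 * (2 * r), (2 * ((2 : ℝ) ^ d * A * K)) ^ 2 * Kbox d (1 / 4 * (2 * r)) + 1,
    by positivity, by positivity, by positivity, ?_⟩
  intro n m hM y y'
  have hmR : (0 : ℝ) < m := by linarith
  have hm : 0 < m := by exact_mod_cast hmR
  have hXm : X < m := by linarith
  -- the m-dependence of the Prop.-2.2 constant removed: (1 − X/m)⁻¹ ≤ 2 for m ≥ 2X + 1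
  have hfrac : (1 - (2 : ℝ) ^ d * (3 * Real.pi / 2 * A * (2 * d * Real.exp δ₀) / m) * K)⁻¹ ≤ 2 := by
    have hXm' : (2 : ℝ) ^ d * (3 * Real.pi / 2 * A * (2 * d * Real.exp δ₀) / m) * K = X / m := by
      rw [hXdef]; field_simp
    rw [hXm']
    have h1 : X / m ≤ 1 / 2 := by
      rw [div_le_iff₀ hmR]; linarith
    have h2 : (1 : ℝ) / 2 ≤ 1 - X / m := by linarith
    calc (1 - X / m)⁻¹ ≤ (1 / 2 : ℝ)⁻¹ := inv_anti₀ (by norm_num) h2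
      _ = 2 := by norm_num
  have hfrac0 : 0 ≤ (1 - (2 : ℝ) ^ d * (3 * Real.pi / 2 * A * (2 * d * Real.exp δ₀) / m) * K)⁻¹ := by
    have hXm' : (2 : ℝ) ^ d * (3 * Real.pi / 2 * A * (2 * d * Real.exp δ₀) / m) * K = X / m := by
      rw [hXdef]; field_simp
    rw [hXm']
    have h1 : X / m ≤ 1 / 2 := by
      rw [div_le_iff₀ hmR]; linarith
    exact inv_nonneg.mpr (by linarith)
  have hker : ∀ x z : Fin d → Fin (n * m + 1),
      |green d n m a x z| ≤ 2 * ((2 : ℝ) ^ d * A * K) * Real.exp (-(r * bdist x z)) := by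
    intro x z
    have h := prop22_entry1_neumannLaplacian (d := d) (n := n) (m := m) hm ha hδ₀ (α := 1 / 2) (by norm_num)
      (by norm_num) hρ (by simpa only [hXdef] using hXm) x z
    refine le_trans h ?_
    have hE : 0 ≤ Real.exp (-(r * bdist x z)) := Real.exp_nonneg _
    calc (2 : ℝ) ^ d * A * K * (1 - (2 : ℝ) ^ d * (3 * Real.pi / 2 * A * (2 * d * Real.exp δ₀) / m) * K)⁻¹ *
          Real.exp (-(r * bdist x z))
        ≤ (2 : ℝ) ^ d * A * K * 2 * Real.exp (-(r * bdist x z)) := by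
          refine mul_le_mul_of_nonneg_right ?_ hE
          exact mul_le_mul_of_nonneg_left hfrac (by positivity)
      _ = 2 * ((2 : ℝ) ^ d * A * K) * Real.exp (-(r * bdist x z)) := by ring
  have h := ineq268_box_of_kernel hr hker y y'
  refine h.trans ?_
  have hE : 0 ≤ Real.exp (-(1 / 4 * (2 * r) * bdist y y')) := Real.exp_nonneg _
  nlinarith [hE, hK'.le]

end Box


end Literature.MathematicalPhysics.QuantumFieldTheory.Balaban1983to89.B6Ineq268OneScaleBox
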